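import Summits.QuantumFields.BalabanUV.T4Continuum.Support.RegionGaugeFixedVectorTop
import Summits.QuantumFields.BalabanUV.T4Continuum.Support.DirichletStarVectorTower

/-!
# T⁴ programme, spine node NE2 (U1a), sub-row Δ1 «NE2⁰-Dirichlet» — THE STAR-BOND VECTOR REGION TOWER OF THE WHOLE TORUS CONVERGES AT
# RATE `L⁻¹`, UNCONDITIONALLY: the owner's sub-carrier END `towerLimitRate_sub_of` with W1, W2, the pairing defect and W3 ALL DISCHARGED at `S = ⊤`

NE2 formalisation swarm `b2b-balaban-t4-ne2-formalise-*`, leaf 07 (gen 6), supplier item «Δ1-COERC» (owner ruling R23 (a)), file 7 — the ⊤-WITNESS of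
the owner's O13-a «STAR-BOND VECTOR REGION TOWER» (journal 2026-08-20 l.16321 / generic half LANDED l.16812: `Support/DirichletSubregionTowerOf`
p224434 + `Support/DirichletSubregionDefect` p225020, END `towerLimitRate_sub_of (hdown) (hherm) (hγ) (hCg) (hcoer) (hgrad) (hF) … (hinj)` for ANY
downward-closed predicate family and ANY Hermitian operator family, W1–W3 and the defect majorant DISPLAYED).  The vector-layer twin of gen 11's
`Support/DirichletFreeTowerTop` (the site-based model at `⊤`).

AT `S = ⊤` EVERY DISPLAYED INPUT IS A THEOREM (files 5–6 of this lineage + the tree's torus laws BY NAME):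
 * carriers `p k := starReg (lev L k) M ⊤` (every index; `hdown` trivial), operators `D k := regionDeltaA (lev L k) M a a′ ⊤` (Hermitian);
 * W1 `hcoer`: `Coercive (D k) γ_D` for every `k` — `RegionGaugeFixedVectorTop.coercive_regionDeltaA_top_sharp` (B5 (1.90) through the operator
   identity `D k = (calDalev k)|`);
 * W2 `hgrad` with the LEVEL-INDEPENDENT constant `Cg k = (d+1)·Cst(d,a)` — `RegionGaugeFixedVectorTop.nsq_fdiff_ext_le_form_top`;
 * the pairing defect VANISHES, **`FpR_top_eq_zero`**: `F_k = (√(L^d)·Q_k·J_k − 1)| = 0` (King's exact pairing `KingPairingPlantedLaw.sqrt_smul_Qlev_mul_JpcT`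
   compressed along everywhere-true predicates), so `hF` holds with `f = 0`;
 * W3 **`injected_star_top`**: `‖(D (k+1))⁻¹·J_k − J_k·(D k)⁻¹‖ ≤ CJ·L^{−k}` — `(D k)⁻¹ = (calDalev k)⁻¹|`
   (`RegionGaugeFixedVectorTop.inv_regionDeltaA_top_eq_calDa`) and King's torus law `KingPairingPlantedLaw.injected_le_lev` [cite: King1986, Lemma 4.5 (4.38) p.674 (shape)].
ENDs **`towerLimitRate_star_top_of_owner (hL : 2 ≤ L) (ha) (ha′)`** = the owner's INSTANCE END `DirichletStarVectorTower.towerLimitRate_star_of`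
(p≥225020's successor, W1 in the `SliceCoercive` currency, defect majorant `fStar`) BY NAME with every displayed input supplied, and the sharper
**`towerLimitRate_star_top_sharp (hL : 2 ≤ L) (ha) (ha′) :
  TowerLimitRate (QpR L M p) (L^d) (fun k => (regionDeltaA (lev L k) M a a′ ⊤)⁻¹) (Cpert 0 (2d·√((d+1)Cst·γ_D⁻¹)) CJ 0 0 0) L⁻¹`** through the
generic END (`f = 0`, full `γ_D`) — NO displayed binder in either.

ROLE / HONEST FRAMING (T4-DAG p. 1).  A CONSISTENCY / NON-VACUITY witness for the owner's star tower: at the whole torus the faithful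
[B9]-shaped `U = 1` vector region operator's King-averaged covariances converge at the torus rate of record.  It says NOTHING about `S ≠ ⊤`
(there W1 = `SliceCoercive` uniformly in the region is the located OPEN estimate `t4/T4-EST-NE2-D1-COERC.md` §6, W2's constant is
level-dependent, W3 is displayed).  Model level (`U = 1`, King's componentwise averaging, one averaging scale inside `D`, finite torus, operator
norm); [folklore] bookkeeping over landed modules; NOT [B9] (3.23)–(3.27) as printed; NE2 (U1a) NOT proved; spine 0/9 unchanged; NOT infinite
volume / mass gap / Clay / summit progress.  HONEST DEPENDENCY: continuum YM on T⁴ ⇐ BetaPertH ∧ nine spine estimates (0/9 proved); BetaPertH ⇐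
(D1) ∧ (D4) ∧ CAP+tail; G-an2-4 gates asym, D1 and NE2/3/4.  No `sorry`.
-/

noncomputable section

open scoped BigOperators ComplexConjugate Matrix Matrix.Norms.L2Operator
open Finset

namespace Summit.QuantumFields.BalabanUV.T4Continuum.DirichletStarVectorTowerTop

open Literature.MathematicalPhysics.QuantumFieldTheory.Balaban1983to89.B5Prop11Plancherel (Tor fine Cst)
open Literature.MathematicalPhysics.QuantumFieldTheory.Balaban1983to89.B5Prop11Lower (nsq)
open Literature.MathematicalPhysics.QuantumFieldTheory.Balaban1983to89.B5G183RateUnitTower (lev lev_neZero)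
open Summit.QuantumFields.BalabanUV.T4Continuum
open Summit.QuantumFields.BalabanUV.T4Continuum.SubtypeCompression (Coercive opNorm_toBlock_le toBlock_mul_of_vanish_left toBlock_smul toBlock_one
  toBlock_sub)
open Summit.QuantumFields.BalabanUV.T4Continuum.RegionGaugeFixedVector (starReg regionDeltaA)
open Summit.QuantumFields.BalabanUV.T4Continuum.RegionGaugeSliceTorus (starReg_topU sliceCoercive_top)
open Summit.QuantumFields.BalabanUV.T4Continuum.RegionGaugeFixedVectorTop (coercive_regionDeltaA_top_sharp nsq_fdiff_ext_le_form_top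
  inv_regionDeltaA_top_eq_calDa)
open Summit.QuantumFields.BalabanUV.T4Continuum.DirichletStarVectorTower (starP regionDeltaA_isHermitian gamStar gamStar_pos fStar
  towerLimitRate_star_of)
open Summit.QuantumFields.BalabanUV.T4Continuum.DirichletRegionTower (gamD gamD_pos)
open Summit.QuantumFields.BalabanUV.T4Continuum.DirichletSubregionTowerOf (pidx QpR JpR FpR towerLimitRate_sub_of)
open Summit.QuantumFields.BalabanUV.T4Continuum.KingPairingPlantedLaw (JpcT calDalev injected_le_lev CJ sqrt_smul_Qlev_mul_JpcT)
open Summit.QuantumFields.BalabanUV.T4Continuum.BalabanAveragedTowerUnit (idx Qlev one_le_lev')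
open Summit.QuantumFields.BalabanUV.T4Continuum.CovariantAveragingTower (TowerLimitRate)
open Summit.QuantumFields.BalabanUV.T4Continuum.BackgroundResolventTower (Cpert)

variable {d : ℕ}

/-! ## The star-bond vector tower of the WHOLE TORUS -/

section Tower

variable (L : ℕ) [NeZero L] (M : Fin d → ℕ) [hM : ∀ μ, NeZero (M μ)] (a a' : ℝ)

/-- at `⊤` the compressed pairing has NO defect: `F_k = 0`. [folklore] -/
theorem FpR_top_eq_zero (k : ℕ) :
    FpR L M (fun k => starReg (lev L k) M (fun _ : Tor M => True)) k = 0 := by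
  rw [FpR, QpR, JpR, ← toBlock_mul_of_vanish_left _ _ _ _ _ (fun i j _ hj => absurd (starReg_topU (lev L (k + 1)) M j) hj),
    ← toBlock_smul, sqrt_smul_Qlev_mul_JpcT, add_zero, toBlock_one, sub_self]

/-- at `⊤` the injected law holds with the torus constant `CJ·L^{−k}` (King's Lemma 4.5 compressed along everywhere-true predicates).
[cite: King1986, Lemma 4.5 (4.38) p.674 (shape)] [folklore] -/
theorem injected_star_top (ha : 0 < a) (ha' : 0 < a') (k : ℕ) :
    ‖(regionDeltaA (lev L (k + 1)) M a a' (fun _ : Tor M => True))⁻¹ * JpR L M (fun k => starReg (lev L k) M (fun _ : Tor M => True)) k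
        - JpR L M (fun k => starReg (lev L k) M (fun _ : Tor M => True)) k * (regionDeltaA (lev L k) M a a' (fun _ : Tor M => True))⁻¹‖
      ≤ CJ d a * ((L : ℝ)⁻¹) ^ k := by
  have e : (regionDeltaA (lev L (k + 1)) M a a' (fun _ : Tor M => True))⁻¹ * JpR L M (fun k => starReg (lev L k) M (fun _ : Tor M => True)) k
        - JpR L M (fun k => starReg (lev L k) M (fun _ : Tor M => True)) k * (regionDeltaA (lev L k) M a a' (fun _ : Tor M => True))⁻¹
      = ((calDalev L M a ha (k + 1))⁻¹ * JpcT L M k - JpcT L M k * (calDalev L M a ha k)⁻¹).toBlock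
          (starReg (lev L (k + 1)) M (fun _ : Tor M => True)) (starReg (lev L k) M (fun _ : Tor M => True)) := by
    rw [inv_regionDeltaA_top_eq_calDa (lev L (k + 1)) M a a' (one_le_lev' L (k + 1)) ha ha',
      inv_regionDeltaA_top_eq_calDa (lev L k) M a a' (one_le_lev' L k) ha ha', JpR, toBlock_sub,
      toBlock_mul_of_vanish_left _ (starReg (lev L (k + 1)) M (fun _ : Tor M => True)) _ _ _
        (fun i j _ hj => absurd (starReg_topU (lev L (k + 1)) M j) hj),
      toBlock_mul_of_vanish_left _ (starReg (lev L k) M (fun _ : Tor M => True)) _ _ _ (fun i j _ hj => absurd (starReg_topU (lev L k) M j) hj)]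
    rfl
  rw [e]
  exact (opNorm_toBlock_le _ _ _).trans (injected_le_lev L M a ha k)

/-- **THE OWNER's STAR END AT `S = ⊤` WITH EVERY DISPLAYED INPUT DISCHARGED** (`L ≥ 2`): `DirichletStarVectorTower.towerLimitRate_star_of`
BY NAME with W1 := `sliceCoercive_top` (one slice constant `γ_D` for all levels), W2 := `nsq_fdiff_ext_le_form_top` (`Cg k = (d+1)·Cst`),
W3 := `injected_star_top`; the owner's defect majorant `fStar` is dominated by `Cf·L^{−k}`, `Cf = γ⋆⁻¹ + √(d(d+1)Cst·γ⋆⁻¹)`,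
`γ⋆ = gamStar d a′ γ_D = min(γ_D/2, γ′/2)`.  NO displayed binder remains. [folklore] -/
theorem towerLimitRate_star_top_of_owner (hL : 2 ≤ L) (ha : 0 < a) (ha' : 0 < a') :
    TowerLimitRate (QpR L M (starP L M (fun _ : Tor M => True))) ((L : ℝ) ^ d)
      (fun k => (regionDeltaA (lev L k) M a a' (fun _ : Tor M => True))⁻¹)
      (Cpert 0 (2 * d * Real.sqrt ((((d : ℝ) + 1) * Cst d a) * (gamStar d a' (gamD d a))⁻¹)) (CJ d a) 0
        ((gamStar d a' (gamD d a))⁻¹ + Real.sqrt (d * (((d : ℝ) + 1) * Cst d a) * (gamStar d a' (gamD d a))⁻¹)) 0)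
      ((L : ℝ)⁻¹) := by
  have hθ1 : ((L : ℝ)⁻¹) < 1 := inv_lt_one_of_one_lt₀ (by exact_mod_cast (lt_of_lt_of_le one_lt_two hL : 1 < L))
  have hγ : 0 < gamStar d a' (gamD d a) := gamStar_pos (d := d) a' (gamD_pos a)
  have hL0 : (0 : ℝ) ≤ (L : ℝ)⁻¹ := inv_nonneg.mpr (Nat.cast_nonneg L)
  refine towerLimitRate_star_of L M a a' (fun _ : Tor M => True) hL ha' (gamD_pos a)
    (fun k => sliceCoercive_top (lev L k) M a a' (one_le_lev' L k) ha ha')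
    (Cg := fun _ => ((d : ℝ) + 1) * Cst d a) (fun _ => le_of_lt (DirichletRegionTower.K_pos a))
    (fun k ν w => nsq_fdiff_ext_le_form_top (lev L k) M a a' (one_le_lev' L k) ha ha' ν w) hθ1 (fun k => le_rfl) ?_
    (injected_star_top L M a a' ha ha')
  -- the owner's defect majorant is geometric at rate `L⁻¹`
  intro k
  cases k with
  | zero =>
      simp only [fStar, pow_zero, mul_one]
      exact le_add_of_nonneg_right (Real.sqrt_nonneg _)
  | succ k =>
      simp only [fStar]
      rw [← inv_pow]
      have h1 : Real.sqrt (d * (((d : ℝ) + 1) * Cst d a) * (gamStar d a' (gamD d a))⁻¹) * ((L : ℝ)⁻¹) ^ (k + 1)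
          ≤ ((gamStar d a' (gamD d a))⁻¹ + Real.sqrt (d * (((d : ℝ) + 1) * Cst d a) * (gamStar d a' (gamD d a))⁻¹))
            * ((L : ℝ)⁻¹) ^ (k + 1) :=
        mul_le_mul_of_nonneg_right (le_add_of_nonneg_left (inv_nonneg.mpr hγ.le)) (pow_nonneg hL0 _)
      exact h1

/-- **THE SHARP FORM THROUGH THE GENERIC SUB-CARRIER END** (`L ≥ 2`): at `⊤` the pairing defect VANISHES (`FpR_top_eq_zero`), so `DirichletSubregionTowerOf.towerLimitRate_sub_of` applies with `f = 0` and the full `γ_D` — the owner's sub-carrier END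
`towerLimitRate_sub_of` with ALL of W1 (`γ_D`), W2 (`Cg k = (d+1)·Cst`, level-independent), the defect majorant (`f = 0`) and W3
(`CJ·L^{−k}`) DISCHARGED at `S = ⊤`. [folklore] -/
theorem towerLimitRate_star_top_sharp (hL : 2 ≤ L) (ha : 0 < a) (ha' : 0 < a') :
    TowerLimitRate (QpR L M (fun k => starReg (lev L k) M (fun _ : Tor M => True))) ((L : ℝ) ^ d)
      (fun k => (regionDeltaA (lev L k) M a a' (fun _ : Tor M => True))⁻¹)
      (Cpert 0 (2 * d * Real.sqrt ((((d : ℝ) + 1) * Cst d a) * (gamD d a)⁻¹)) (CJ d a) 0 0 0) ((L : ℝ)⁻¹) := by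
  have hθ1 : ((L : ℝ)⁻¹) < 1 := inv_lt_one_of_one_lt₀ (by exact_mod_cast (lt_of_lt_of_le one_lt_two hL : 1 < L))
  refine towerLimitRate_sub_of L M (fun k => starReg (lev L k) M (fun _ : Tor M => True)) (fun k => regionDeltaA (lev L k) M a a' (fun _ : Tor M => True))
    (fun k y _ => starReg_topU (lev L k) M _) (fun k => regionDeltaA_isHermitian (lev L k) M a a' (fun _ : Tor M => True)) (gamD_pos a)
    (Cg := fun _ => ((d : ℝ) + 1) * Cst d a) (fun _ => le_of_lt (DirichletRegionTower.K_pos a))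
    (fun k => coercive_regionDeltaA_top_sharp (lev L k) M a a' (one_le_lev' L k) ha ha')
    (fun k ν w => nsq_fdiff_ext_le_form_top (lev L k) M a a' (one_le_lev' L k) ha ha' ν w)
    (f := fun _ => 0) (fun k => by rw [FpR_top_eq_zero, Matrix.zero_mul, norm_zero]) hθ1 (fun k => le_rfl)
    (fun k => by rw [zero_mul]) (injected_star_top L M a a' ha ha')

end Tower

end Summit.QuantumFields.BalabanUV.T4Continuum.DirichletStarVectorTowerTop

end
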